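import Summits.QuantumFields.BalabanUV.Beta.SymSecondOrderClassBase
import Summits.QuantumFields.BalabanUV.Beta.CombSecondOrderClassStep

/-!
# `BalabanUV.Beta.CombSecondOrderClassBase` — binder row D1, RULING R-D1-g35-1 (chart (III′)), programme P6 (localisation tail): **THE (III′) TWIN OF `SymSecondOrderClassBase`** — the same
# localisation∕class bookkeeping for the chart-(III′) remainder tables `combR2An1`∕`combΔAn1` (`CombSecondOrderRemainderAn1`) at the comb-chart resolvents `GcombSh Lc j`;
# ONLY the literal instances are twinned (`Gsym ↦ GcombSh`, `decays_Gsym ↦ decays_GcombSh`, `symR2An1 ↦ combR2An1`): the resolvent-generic §1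
# `SymSecondOrderClassBase.locStencil₂_reflDefect`, `SymSecondOrderClassStep.pkg_of_spr` and `SymSecondOrderSplitLoc` §1∕§5 are IMPORTED AND REUSED BY
# NAME, not restated.
# * §2 `locStencil₂_T2RecOf_symTablesAn1` — `T2RecOf … (GcombSh Lc) …` of the chart-(III′) literal is `LocStencil₂`, every level.
# * §3 `locStencil₂_combR2An1_zero` — THE BASE: `combR2An1 Lc N cΛ γ X2s 0 α` is a `LocStencil₂` family.

HONEST FRAMING (cell contract, verbatim): «discharging `BetaPertH` makes Bałaban's UV stability UNCONDITIONAL — a real constructive-QFT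
result; it is NOT the continuum limit and NOT the Clay problem.»  HONEST DEPENDENCY: continuum YM on T⁴ ⇐ BetaPertH ∧ nine spine estimates (0/9 proved);
BetaPertH ⇐ (D1) ∧ (D4) ∧ CAP+tail; G-an2-4 gates asym, D1 and NE2/3/4.  DERIVED cell leaf ([folklore] BY NAME; β sub-cell, row-D1 OWNER `b2b-balaban-beta-an2` gen 36;
chart (II) original by the D1 formalisation swarm leaf-03∕leaf-10 and the owner).  No statement of Bałaban's papers, no `[cite:]`, no `Prop` fact, no `def`.
RECORD = ROOT M′ p303989 (chart (II)) unchanged; NOT D1, NOT `BetaPertH`, NOT continuum, NOT Clay.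
Provenance: β sub-cell, unit beta-an2 gen 36 (v1 draft, text-transformed) ∕ gen 37 (v2: generic lemmas imported, 2026-08-22); no existing file touched.
-/

noncomputable section

open Finset
open scoped BigOperators
open Literature.MathematicalPhysics.QuantumFieldTheory
open Literature.MathematicalPhysics.QuantumFieldTheory.Balaban1983to89
open Literature.MathematicalPhysics.QuantumFieldTheory.Balaban1983to89.Beta
open B12Sec2to5 (l1 l1_nonneg)
open ExpKernelCalculus (MKer Decays BiLoc VertexFamily)
open PolarizationSign (reflSign)
open KernelReflection (refK)
open ResolventReflection (bref Φ)
open KernelWard (biLoc_add biLoc_sub)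
open AveragingContoursRooted (ctr ctrOff ctrOff_mem_box)
open OneStepResolventKernel (Fib LocStencil biLoc_mono)
open BalabanCompositeJets (LocStencil₂)
open BalabanStepW2 (locStencil₂_smul' locStencil₂_add')
open WilsonVertex2Sym (wsym22)
open Summit.QuantumFields.BalabanUV.Beta.TameKernelCalculus
open Summit.QuantumFields.BalabanUV.Beta.ChartConjugation (conjV conjW)
open Summit.QuantumFields.BalabanUV.Beta.AxialDressingRooted (one_le_of_neZero)
open Summit.QuantumFields.BalabanUV.Beta.BorderedHessian (bhK diagK spr_bhK)
open Summit.QuantumFields.BalabanUV.Beta.SecondOrderBorderGauge (actB)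
open Summit.QuantumFields.BalabanUV.Beta.SecondOrderBorderClassKit (locStencil₂_actB locStencil₂_conjW)
open Summit.QuantumFields.BalabanUV.Beta.CombChartStepJets (GcombSh decays_GcombSh)
open Summit.QuantumFields.BalabanUV.Beta.DshAn1 (Dsh)
open Summit.QuantumFields.BalabanUV.Beta.SpineRooted (M1Of SpureRecOf T2RecOf locStencil_SpureRecOf vertexFamily_M1Of T2RecOf_loc)
open Summit.QuantumFields.BalabanUV.Beta.SymShiftedSpread (bhKStepSh spr_bhKStepSh)
open Summit.QuantumFields.BalabanUV.Beta.RelInvNullShift (spr_add)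
open Summit.QuantumFields.BalabanUV.Beta.DshAn1 (Dsh spr_Dsh)
open Summit.QuantumFields.BalabanUV.Beta.E3ContactGenerator (ctGenM)
open Summit.QuantumFields.BalabanUV.Beta.SymAveragingHessianCounts (symVhSAt symHessFFAt symVhSAt_hV_ctr symHessFFAt_hH_ctr)
open Summit.QuantumFields.BalabanUV.Beta.SymAveragingMixedJetTables (symMixFFAt)
open Summit.QuantumFields.BalabanUV.Beta.SymSecondOrderTablesAn1 (symVh₂SAn1 locStencil₂_symVh₂SAn1 symMixFFAt_hmix_ctr)
open Summit.QuantumFields.BalabanUV.Beta.SymSecondOrderSplitLoc (locStencil_diagK_mul_ctGenM locStencil₂_diagK_ctGenM_mul_ctGenM)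
open Summit.QuantumFields.BalabanUV.Beta.CombSecondOrderRemainderAn1 (combR2An1)
open Summit.QuantumFields.BalabanUV.Beta.SymSecondOrderClassStep (pkg_of_spr)
open Summit.QuantumFields.BalabanUV.Beta.SymSecondOrderClassBase (locStencil₂_reflDefect)

namespace Summit.QuantumFields.BalabanUV.Beta.CombSecondOrderClassBase

variable {d : ℕ}

/-! ## §2 The (0.4) literal's second-order table `T2RecOf … j` is a `LocStencil₂` family -/

section Literal

variable {Lc : ℕ} [NeZero Lc]

/-- [folklore] **`T2RecOf` OF THE (0.4) LITERAL IS `LocStencil₂`, EVERY LEVEL** — `SpineRooted.T2RecOf_loc` at the sym suppliers (DG)(LS)(LM)(LB)(Lmix)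
(no `Odd Lc`, no lock). -/
theorem locStencil₂_T2RecOf_symTablesAn1 (N : ℕ) (cΛ : ℝ) :
    ∀ j : ℕ, ∃ C δ : ℝ, 0 < δ ∧ LocStencil₂
      (T2RecOf 3 Lc (GcombSh Lc) (SpureRecOf 3 Lc (symVhSAt (ctr 4 Lc) 3 Lc rfl) (symHessFFAt (ctr 4 Lc) Lc) (GcombSh Lc) ((Lc : ℝ) ^ 4) (-((Lc : ℝ) ^ 8 / 2)) cΛ)
        (M1Of 3 Lc (symHessFFAt (ctr 4 Lc) Lc) cΛ) ((Lc : ℝ) ^ 8) (-((Lc : ℝ) ^ 12 / 4)) ((8 * (N : ℝ) ^ 2)⁻¹ • wsym22 N) (symVh₂SAn1 3 Lc)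
        (symMixFFAt (ctr 4 Lc) Lc) j) C δ := by
  have hL1 : 1 ≤ Lc := one_le_of_neZero Lc
  obtain ⟨C1, hH1⟩ := symHessFFAt_hH_ctr (d := 3) hL1 1 zero_le_one
  exact T2RecOf_loc ((Lc : ℝ) ^ 8) (-((Lc : ℝ) ^ 12 / 4)) ((8 * (N : ℝ) ^ 2)⁻¹ • wsym22 N) (symVh₂SAn1 3 Lc) (symMixFFAt (ctr 4 Lc) Lc) hL1
    (decays_GcombSh Lc)
    (locStencil_SpureRecOf (d := 3) hL1 (symVhSAt_hV_ctr (d := 3) hL1) (symHessFFAt_hH_ctr (d := 3) hL1) (decays_GcombSh Lc) _ _ cΛ)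
    (fun j => ⟨_, 1, one_pos, vertexFamily_M1Of hH1 cΛ j⟩) (locStencil₂_symVh₂SAn1 hL1) (symMixFFAt_hmix_ctr hL1)

/-! ## §3 THE BASE: `combR2An1 … 0 α` is a `LocStencil₂` family -/

/-- [folklore] **THE BASE OF THE CLASS INDUCTION: the OWNER's level-0 remainder `combR2An1 Lc N cΛ γ X2s 0 α` is a `LocStencil₂` family** at some
positive rate, for every `N`, `cΛ`, `γ`, `X2s`, `α` (the reflection action of the level-0 table, the table, and the level-0 contact family — all
`LocStencil₂` at a common rate; no `Odd Lc`, no lock, no letter). -/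
theorem locStencil₂_combR2An1_zero (N : ℕ) (cΛ : ℝ) (γ : ℕ → ℝ)
    (X2s : ℕ → Fin 4 → Fin 4 → (Fin 4 → ℤ) → Fin 4 → (Fin 4 → ℤ) → (Fin 4 → ℤ) → Fib 3 → ℝ) (α : Fin 4) :
    ∃ C δ : ℝ, 0 < δ ∧ LocStencil₂ (combR2An1 Lc N cΛ γ X2s 0 α) C δ := by
  have hL1 : 1 ≤ Lc := one_le_of_neZero Lc
  -- the level-0 table
  obtain ⟨CT, δT, hδT, hT⟩ := locStencil₂_T2RecOf_symTablesAn1 (Lc := Lc) N cΛ 0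
  -- the letters of the contact family, at their own rates
  obtain ⟨δM, CM, hδM, hCM, hMd⟩ := pkg_of_spr (spr_bhKStepSh (d := 3) (Lc := Lc) (spr_Dsh hL1) 0)
  obtain ⟨δB, CB, hδB, hCB, hBd⟩ := pkg_of_spr (spr_add (spr_bhK (d := 3) hL1) (spr_Dsh hL1))
  obtain ⟨Cs, δs, hδs, hS⟩ := locStencil_SpureRecOf (d := 3) hL1 (symVhSAt_hV_ctr (d := 3) hL1) (symHessFFAt_hH_ctr (d := 3) hL1)
    (decays_GcombSh Lc) ((Lc : ℝ) ^ 4) (-((Lc : ℝ) ^ 8 / 2)) cΛ 0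
  have hX := locStencil_diagK_mul_ctGenM hBd hδB.le (γ 0) α Lc
  have hX₂ := locStencil₂_diagK_ctGenM_mul_ctGenM hBd hδB.le (γ 0) (γ 0) α Lc
  -- one common rate
  set m : ℝ := min (min δT δM) (min δs (δB / 3)) with hm_def
  have hm : 0 < m := lt_min (lt_min hδT hδM) (lt_min hδs (by positivity))
  have hmT : m ≤ δT := (min_le_left _ _).trans (min_le_left _ _)
  have hmM : m ≤ δM := (min_le_left _ _).trans (min_le_right _ _)
  have hms : m ≤ δs := (min_le_right _ _).trans (min_le_left _ _)
  have hmB3 : m ≤ δB / 3 := (min_le_right _ _).trans (min_le_right _ _)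
  have hmB2 : m ≤ δB / 2 := hmB3.trans (by linarith)
  have hCs : 0 ≤ Cs := (hS 0 0).nonneg (Sum.inl 0)
  have hTm := hT.mono (m := m) hmT
  have hMm : Decays (bhKStepSh 3 Lc (Dsh Lc) 0) (|CM|) m := decays_of_le hMd hmM
  have hSm : LocStencil (SpureRecOf 3 Lc (symVhSAt (ctr 4 Lc) 3 Lc rfl) (symHessFFAt (ctr 4 Lc) Lc) (GcombSh Lc) ((Lc : ℝ) ^ 4) (-((Lc : ℝ) ^ 8 / 2)) cΛ 0)
      Cs m := fun κ u => biLoc_mono (hS κ u) hCs hms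
  have hXm : LocStencil (fun κ u => diagK fun p a => γ 0 * ctGenM 3 (bhK Lc + Dsh Lc) α Lc κ u p a)
      (|(|γ 0| * (1 + ((Lc : ℝ) ^ (3 + 1))⁻¹ * CB))|) m := fun κ u => biLoc_of_le (hX κ u) hmB2
  have hX₂m := hX₂.mono (m := m) hmB3
  -- the contact family
  obtain ⟨CW, hW⟩ := locStencil₂_conjW hMm hSm hXm hX₂m hm
  -- assemble at rate m/8
  have h := locStencil₂_reflDefect (d := 3) hL1 α (hTm.mono (m := m / 8) (by linarith)) hW (by positivity)
  have e : combR2An1 Lc N cΛ γ X2s 0 α = fun κ u κ' u' =>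
      actB Lc α (T2RecOf 3 Lc (GcombSh Lc) (SpureRecOf 3 Lc (symVhSAt (ctr 4 Lc) 3 Lc rfl) (symHessFFAt (ctr 4 Lc) Lc) (GcombSh Lc) ((Lc : ℝ) ^ 4) (-((Lc : ℝ) ^ 8 / 2)) cΛ)
          (M1Of 3 Lc (symHessFFAt (ctr 4 Lc) Lc) cΛ) ((Lc : ℝ) ^ 8) (-((Lc : ℝ) ^ 12 / 4)) ((8 * (N : ℝ) ^ 2)⁻¹ • wsym22 N) (symVh₂SAn1 3 Lc)
          (symMixFFAt (ctr 4 Lc) Lc) 0) κ u κ' u' -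
        T2RecOf 3 Lc (GcombSh Lc) (SpureRecOf 3 Lc (symVhSAt (ctr 4 Lc) 3 Lc rfl) (symHessFFAt (ctr 4 Lc) Lc) (GcombSh Lc) ((Lc : ℝ) ^ 4) (-((Lc : ℝ) ^ 8 / 2)) cΛ)
          (M1Of 3 Lc (symHessFFAt (ctr 4 Lc) Lc) cΛ) ((Lc : ℝ) ^ 8) (-((Lc : ℝ) ^ 12 / 4)) ((8 * (N : ℝ) ^ 2)⁻¹ • wsym22 N) (symVh₂SAn1 3 Lc)
          (symMixFFAt (ctr 4 Lc) Lc) 0 κ u κ' u' -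
        conjW (bhKStepSh 3 Lc (Dsh Lc) 0)
          (SpureRecOf 3 Lc (symVhSAt (ctr 4 Lc) 3 Lc rfl) (symHessFFAt (ctr 4 Lc) Lc) (GcombSh Lc) ((Lc : ℝ) ^ 4) (-((Lc : ℝ) ^ 8 / 2)) cΛ 0 κ u)
          (SpureRecOf 3 Lc (symVhSAt (ctr 4 Lc) 3 Lc rfl) (symHessFFAt (ctr 4 Lc) Lc) (GcombSh Lc) ((Lc : ℝ) ^ 4) (-((Lc : ℝ) ^ 8 / 2)) cΛ 0 κ' u')
          ((fun κ u => diagK fun p a => γ 0 * ctGenM 3 (bhK Lc + Dsh Lc) α Lc κ u p a) κ u)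
          ((fun κ u => diagK fun p a => γ 0 * ctGenM 3 (bhK Lc + Dsh Lc) α Lc κ u p a) κ' u')
          ((fun κ u κ' u' => diagK fun p a => (γ 0 * ctGenM 3 (bhK Lc + Dsh Lc) α Lc κ u p a) * (γ 0 * ctGenM 3 (bhK Lc + Dsh Lc) α Lc κ' u' p a)) κ u κ' u') := by
    funext κ u κ' u'; rfl
  rw [e]
  exact ⟨_, m / 8, by positivity, h⟩

end Literal

end Summit.QuantumFields.BalabanUV.Beta.CombSecondOrderClassBase

end
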